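import Literature.MathematicalPhysics.QuantumFieldTheory.Balaban1983to89.B11LeafKnit
import Literature.MathematicalPhysics.QuantumFieldTheory.Balaban1983to89.B11Prop9Model

/-!
# `Balaban1983to89.B11LeafKnitProp9` — T. Bałaban, *The variational problem and background fields in renormalization group method for
# lattice gauge theories*, Commun. Math. Phys. **102** (1985) 277–309 [Balaban1985Variational]: **the Prop-9 slot of the N07 knit filled BY
# NAME by the Sect. E–G model family** (`B11Prop9Model.prop9Printed_model_of_le`, seat dag-n07-b, p409218) — the coherence conditions between
# the B11 bundle's shared letters (C₁, β₀, δ₀, B₅) and the model's constants `q : B11Prop9Model.GConsts` made kernel-explicit (referee ref-C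
# READ #15 condition (f))

statement-level bookkeeping over published theorems with citation tags; proofs = kernel composition of landed modules BY NAME; nothing here
is a claim about the Yang–Mills mass gap

PDF held: `paper:balaban1985-cmp102-variational-background` (journal page = PDF page + 276).

CITATION HEADER (lean-in-tree rule 2026-08-18) / WHAT IS REPRODUCED.  Cell `pub-ymgap`, Track A node N07 = [B11], prover seat
`pub-ymgap-dag-n07-a` (KNIT-BY-NAME), eighth module.  A NEW LEAF over the seat's `B11LeafKnit` and dag-n07-b's `B11Prop9Model`; nothing there is
modified; NO definition (theorems only).
§1 `prop9_conjunct_of_model`: for a bundle `Z` whose Prop-9 family IS a Sect. E–G model family, `Z.famAn = fun i ↦ (δ i).toAnData` with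
   `δ i : B11Prop9Model.SectGDatum q …` sharing valid constants `q`, and whose letters satisfy `Z.C₁ = q.C₁`, `Z.β₀ = q.β₀`, `Z.δ₀ = q.δ₀`,
   `q.B5 ≤ Z.B₅` (print's B₅ = 6B₁B₃C₁ of (173) when larger), the leaf's conjunct p9 holds — `prop9Printed_model_of_le` BY NAME.
§2 `b11Leaf_of_parts_prop9Model`, `b11_main_of_parts_prop9Model`: `B11LeafKnit.b11Leaf_of_parts` / `b11_main_of_parts` with the p9 input so
   supplied: the leaf and the node N07 from Props 2, 3, 4, 5, 6, 8, Sect. F + dictionary + a Prop-9 MODEL family with coherent letters.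
§3 `b11Leaf_of_isEmpty`: VACUITY GUARD — on an EMPTY index the leaf holds for any carriers and constants (every conjunct is «∃ constants, ∀ i»),
   so a pin must exhibit an inhabited index (referee condition (a)); negative knowledge, cf. `Node00.nonempty_printedCarriers11`.
HONEST SCOPE.  The model family is a model (its analytic inputs `SectGDatum.Letters`, incl. `maj189` = the author-omitted (189) p. 308, GAPS
G-B11-G2, are data of the index, not lattice theorems); count-neutral; NOT a discharge of N07 (B11 group FREE at NODE 00 Stages 1–3); one
finite T⁴ programme at fixed ε; Bałaban AS PRINTED with locators; nothing continuum / ℝ⁴ / OS / mass-gap / Clay.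
-/

noncomputable section

namespace Literature.MathematicalPhysics.QuantumFieldTheory.Balaban1983to89.B11LeafKnitProp9

open Literature.MathematicalPhysics.QuantumFieldTheory.Balaban1983to89
open Literature.MathematicalPhysics.QuantumFieldTheory.Balaban1983to89.B11
open Literature.MathematicalPhysics.QuantumFieldTheory.Balaban1983to89.DagBinding
open Literature.MathematicalPhysics.QuantumFieldTheory.Balaban1983to89.B11Prop7Assembly (Bridge ExistenceLeavesCap)
open Literature.MathematicalPhysics.QuantumFieldTheory.Balaban1983to89.B11Prop9Model (GConsts SectGDatum)

variable (Z : PrintedCarriers11) {q : GConsts} {𝔄f ιf 𝒴f 𝒵f Bdryf : Z.I11 → Type} [∀ i, NormedRing (𝔄f i)]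
  [∀ i, NormedAlgebra ℂ (𝔄f i)] [∀ i, CompleteSpace (𝔄f i)] [∀ i, Fintype (ιf i)] [∀ i, NormedAddCommGroup (𝒴f i)]
  [∀ i, NormedSpace ℂ (𝒴f i)] [∀ i, CompleteSpace (𝒴f i)] [∀ i, NormedAddCommGroup (𝒵f i)] [∀ i, NormedSpace ℂ (𝒵f i)]
  [∀ i, CompleteSpace (𝒵f i)]

/-! ## §1. The p9 conjunct from the model family with coherent letters -/

/-- **The leaf's Prop-9 conjunct `B11.Prop9Printed Z.B₅ Z.C₁ Z.β₀ Z.δ₀ Z.famAn` from a Sect. E–G MODEL family** (`B11Prop9Model.prop9Printed_model_of_le`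
BY NAME) when the bundle's Prop-9 family is that model family and the shared letters cohere: `Z.C₁ = q.C₁`, `Z.β₀ = q.β₀`, `Z.δ₀ = q.δ₀`,
`q.B5 ≤ Z.B₅` (referee condition (f)). [cite: Balaban1985Variational, Prop. 9 p.309; (173) p.305] -/
theorem prop9_conjunct_of_model (hq : q.Valid) (δ : ∀ i, SectGDatum q (𝔄f i) (ιf i) (𝒴f i) (𝒵f i) (Bdryf i))
    (hfam : Z.famAn = fun i => (δ i).toAnData) (hC₁ : Z.C₁ = q.C₁) (hβ₀ : Z.β₀ = q.β₀) (hδ₀ : Z.δ₀ = q.δ₀) (hB₅ : q.B5 ≤ Z.B₅) :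
    Prop9Printed Z.B₅ Z.C₁ Z.β₀ Z.δ₀ Z.famAn := by
  rw [hfam, hC₁, hβ₀, hδ₀]
  exact B11Prop9Model.prop9Printed_model_of_le hq hB₅ δ

/-! ## §2. The leaf and the node with the Prop-9 slot filled by the model family -/

/-- **The B11 leaf from Props 2, 3, 4, 5, 6, 8, Sect. F, the dictionary, and a Prop-9 MODEL family with coherent letters**
(`B11LeafKnit.b11Leaf_of_parts` with p9 := `prop9_conjunct_of_model`). [cite: Balaban1985Variational, Thm 1 p.279, Props 2–9 pp.281–309] -/
theorem b11Leaf_of_parts_prop9Model (β : ∀ i, Bridge (Z.famX i) (Z.famLG i)) {O₁ O₂ e₅ a : ℝ}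
    (laws : ∀ i, (β i).Laws Z.C₁ Z.B₃) (leaves : ∀ i, ExistenceLeavesCap (β i) Z.B₀ Z.B₃ Z.C₁ O₁ O₂ e₅)
    (plaws : ∀ i, (Z.famX i).Laws)
    (hB₀ : 0 < Z.B₀) (hB₁ : 0 < Z.B₁) (hB₃ : 1 ≤ Z.B₃) (hC₁ : 1 ≤ Z.C₁) (hB₀B₁ : Z.B₀ ≤ 4 * Z.B₁) (hc₁ : 0 < Z.c₁)
    (hO₁ : 0 < O₁) (hO₂ : 0 < O₂) (he₅ : 0 < e₅) (ha : 0 < a)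
    (hbg : ∀ (i : Z.I11) (ε₁ : ℝ) (V : (Z.famX i).Bdry), 0 < ε₁ → ε₁ ≤ a → (Z.famX i).Reg7 ε₁ V →
      ∃ U₀ : (Z.famLG i).Cfg, (Z.famLG i).Sat14 (Z.C₁ * Z.B₃ * ε₁) (Z.C₁ * ε₁) ((β i).bdry V) U₀)
    (hV : Z.famV = fun i => (Z.famX i).toVarProblem)
    (p2 : Prop2Printed Z.B₁ Z.B₃ Z.C₁ Z.c₁ Z.famLG) (p3 : Prop3Printed Z.C₁ Z.B₃ Z.C₂ Z.C₃ Z.B₀ Z.c1h Z.c₄ Z.δ₀ Z.famLG)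
    (p4 : Prop4Printed Z.C₁ Z.B₃ Z.famLG) (p5 : Prop5Printed Z.B₁ Z.B₃ Z.C₁ Z.famLG) (p6 : Prop6Printed Z.B₀ Z.B₃ Z.C₁ Z.famLG)
    (p8 : Prop8Printed Z.B₃ Z.famX) (sF : SectFPrinted Z.B₃ Z.famX)
    (hq : q.Valid) (δ : ∀ i, SectGDatum q (𝔄f i) (ιf i) (𝒴f i) (𝒵f i) (Bdryf i))
    (hfam : Z.famAn = fun i => (δ i).toAnData) (hC₁q : Z.C₁ = q.C₁) (hβ₀ : Z.β₀ = q.β₀) (hδ₀ : Z.δ₀ = q.δ₀) (hB₅ : q.B5 ≤ Z.B₅) :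
    B11Leaf Z :=
  B11LeafKnit.b11Leaf_of_parts Z β laws leaves plaws hB₀ hB₁ hB₃ hC₁ hB₀B₁ hc₁ hO₁ hO₂ he₅ ha hbg hV p2 p3 p4 p5 p6 p8 sF
    (prop9_conjunct_of_model Z hq δ hfam hC₁q hβ₀ hδ₀ hB₅)

/-- **The node N07 at a binding of record with the Prop-9 slot filled by the model family** (`B11LeafKnit.b11_main_of_leaf` on
`b11Leaf_of_parts_prop9Model`).  Nothing is discharged. [cite: Balaban1985Variational, Thm 1 p.279, Props 2–9 pp.281–309] -/
theorem b11_main_of_parts_prop9Model (w : WorldP) (P : B12.RunParams) (X : PrintedCarriersR) (Y : PrintedCarriers9X)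
    (V : PrintedCarriers14R) (W : PrintedCarriers15) (hP : w.up P = Upstream.ofPrintedAllXPN X Y Z V W)
    (β : ∀ i, Bridge (Z.famX i) (Z.famLG i)) {O₁ O₂ e₅ a : ℝ}
    (laws : ∀ i, (β i).Laws Z.C₁ Z.B₃) (leaves : ∀ i, ExistenceLeavesCap (β i) Z.B₀ Z.B₃ Z.C₁ O₁ O₂ e₅)
    (plaws : ∀ i, (Z.famX i).Laws)
    (hB₀ : 0 < Z.B₀) (hB₁ : 0 < Z.B₁) (hB₃ : 1 ≤ Z.B₃) (hC₁ : 1 ≤ Z.C₁) (hB₀B₁ : Z.B₀ ≤ 4 * Z.B₁) (hc₁ : 0 < Z.c₁)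
    (hO₁ : 0 < O₁) (hO₂ : 0 < O₂) (he₅ : 0 < e₅) (ha : 0 < a)
    (hbg : ∀ (i : Z.I11) (ε₁ : ℝ) (V : (Z.famX i).Bdry), 0 < ε₁ → ε₁ ≤ a → (Z.famX i).Reg7 ε₁ V →
      ∃ U₀ : (Z.famLG i).Cfg, (Z.famLG i).Sat14 (Z.C₁ * Z.B₃ * ε₁) (Z.C₁ * ε₁) ((β i).bdry V) U₀)
    (hV : Z.famV = fun i => (Z.famX i).toVarProblem)
    (p2 : Prop2Printed Z.B₁ Z.B₃ Z.C₁ Z.c₁ Z.famLG) (p3 : Prop3Printed Z.C₁ Z.B₃ Z.C₂ Z.C₃ Z.B₀ Z.c1h Z.c₄ Z.δ₀ Z.famLG)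
    (p4 : Prop4Printed Z.C₁ Z.B₃ Z.famLG) (p5 : Prop5Printed Z.B₁ Z.B₃ Z.C₁ Z.famLG) (p6 : Prop6Printed Z.B₀ Z.B₃ Z.C₁ Z.famLG)
    (p8 : Prop8Printed Z.B₃ Z.famX) (sF : SectFPrinted Z.B₃ Z.famX)
    (hq : q.Valid) (δ : ∀ i, SectGDatum q (𝔄f i) (ιf i) (𝒴f i) (𝒵f i) (Bdryf i))
    (hfam : Z.famAn = fun i => (δ i).toAnData) (hC₁q : Z.C₁ = q.C₁) (hβ₀ : Z.β₀ = q.β₀) (hδ₀ : Z.δ₀ = q.δ₀) (hB₅ : q.B5 ≤ Z.B₅) :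
    Dag.B11_main (leavesP w P) :=
  B11LeafKnit.b11_main_of_leaf w P X Y Z V W hP
    (b11Leaf_of_parts_prop9Model Z β laws leaves plaws hB₀ hB₁ hB₃ hC₁ hB₀B₁ hc₁ hO₁ hO₂ he₅ ha hbg hV p2 p3 p4 p5 p6 p8 sF hq δ hfam
      hC₁q hβ₀ hδ₀ hB₅)

/-! ## §3. Vacuity guard: the leaf is trivially true on an EMPTY index -/

/-- **Vacuity guard (referee condition (a), «non-empty index»).**  Every conjunct of `DagBinding.B11Leaf Z` has the shape «∃ constants > 0,
∀ i : Z.I11, …», so on a bundle with EMPTY index the leaf holds for ANY carriers and constants — a pin of the B11 group that does not exhibit an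
inhabited index (Bałaban's variational problems for the geometric data of record) discharges nothing.  Recorded as negative knowledge next to
the knit; cf. `Node00.nonempty_printedCarriers11` (module `Node00/Satisfiable`: degenerate inhabitants of the bundle types). [cite: Balaban1985Variational, Thm 1 p.279, Props 2–9 pp.281–309 (bookkeeping)] -/
theorem b11Leaf_of_isEmpty (h : IsEmpty Z.I11) : B11Leaf Z where
  t1 := ⟨1, 1, 1, 1, fun _ => 1, one_pos, one_pos, one_pos, one_pos, by norm_num, fun _ _ => one_pos, fun i => isEmptyElim i⟩
  p2 := fun i => isEmptyElim i
  p3 := ⟨1, one_pos, fun i => isEmptyElim i⟩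
  p4 := ⟨1, 1, 1, one_pos, one_pos, one_pos, fun i => isEmptyElim i⟩
  p5 := ⟨1, one_pos, fun i => isEmptyElim i⟩
  p6 := ⟨1, one_pos, fun i => isEmptyElim i⟩
  p7 := ⟨1, 1, 1, one_pos, one_pos, one_pos, fun i => isEmptyElim i⟩
  p8 := ⟨1, one_pos, fun i => isEmptyElim i⟩
  sF := ⟨1, 1, 1, one_pos, one_pos, one_pos, fun i => isEmptyElim i⟩
  p9 := ⟨1, 1, one_pos, one_pos, fun i => isEmptyElim i⟩

end Literature.MathematicalPhysics.QuantumFieldTheory.Balaban1983to89.B11LeafKnitProp9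

end
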